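import Summits.HodgeConjecture.HodgeConjecture.Theorems.Ring2WeilCoverageRamifiedTypes
import Summits.HodgeConjecture.HodgeConjecture.Theorems.Ring2WeilCoverageRamifiedPrimePowers
import Summits.HodgeConjecture.HodgeConjecture.Theorems.Ring2WeilCoverageRamifiedPrimePowerFive
import Summits.HodgeConjecture.HodgeConjecture.Theorems.Ring2WeilCoverageCyclotomicSignaturesG4
import HarnessLib

/-!
# Weil-type family coverage — RAMIFIED TYPES AT THE `g = 4` NO LEVEL `15`: every Weil-type (`ℚ(√−15)`- or
# `ℚ(√−3)`-balanced) CM type of `ℚ(ζ₁₅)` carries a polarisation of type `𝔮₅` (`𝔮₅⁴ = (5)`, degree `5`) and one of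
# type `𝔮₃` (`𝔮₃² = (3)`, degree `9`) on `ℂ^Φ/Φ(ℤ[ζ₁₅])`, though none of degree `1`; and the dichotomy «principal XOR
# ramified type» for all `16` CM types

research route conditional on HC_CM; not a corollary; Q11.4-sentence-2 already refuted in dim ≥ 3.

Ring 2, WEIL-TYPE FAMILY-COVERAGE CENSUS (`HOME/WEIL-FAMILY-COVERAGE.md` `## b01`, block b01.46 «the cyclotomic CM
FOURFOLDS of Weil type» (C2); owner ring2-b01), part 80 of the `Ring2WeilCoverage*` series = part 49a
(`…RamifiedTypesLevels21and28`) at the fourfold level `15`.  Part 75 proved that the Weil-type `ℤ[ζ₁₅]`-fourfolds — the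
`K`-balanced principal tori `ℂ^Φ/Φ(ℤ[ζ₁₅])`, `K = ℚ(√−15)` (`N_K = {7, 11, 13, 14}`) or `ℚ(√−3)` (`N_K = {2, 8, 11, 14}`) —
carry NO `ι`-compatible principal polarisation, and part 77 that they carry type `(ϖ₀)` iff `N_{ℚ(ζ₁₅)⁺/ℚ}(ϖ₀) < 0`.  Part 48's
engine (`π = ζ^h(1 − ζ^a)(1 − ζ^b)` real with `ζ^a` of prime-power order: `(π) = (1 − ζ^a)`, type verdict by the parity of
`|S_Φ ∩ X_π|`, `X_π = N_odd ∆ A_π`) names two such types EXPLICITLY, with their degrees, and without computing a norm: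

* `𝔮₅`: `π₅ = ζ¹³(1 − ζ³)(1 − ζ)` (`ζ³` a primitive `5`-th root; `(π₅) = (1 − ζ³) = 𝔓₅`, the prime of `ℤ[ζ₁₅]` over `5`,
  `(π₅)⁴ = (5)`): `twistSet_fifteen_five` (`X = {2, 8, 11, 14}` — which IS `N_{ℚ(√−3)}`; `A_π = {1,2,4,11,13,14}`,
  `|A_π|/2 = 3` odd), `map_type_pow_fifteen_five` (`(𝔬𝔣₀)⁴ = (5)`: degree `N_{K⁺/ℚ}(𝔣₀) = 5`),
  **`exists_type_fifteen_five_sqrt_neg_fifteen`**, **`exists_type_fifteen_five_sqrt_neg_three`** (EVERY balanced `Φ`: a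
  `Φ`-positive divisor of type `𝔣₀`, `𝔬𝔣₀ = (π₅)`), headline **`exists_ramifiedType_fifteen_five_…`**,
  **`exists_principal_xor_type_fifteen_five`** (all `16` CM types: principal XOR type `𝔮₅`);
* `𝔮₃`: `π₃ = ζ¹²(1 − ζ⁵)(1 − ζ)` (`ζ⁵` a primitive cube root; `(π₃) = (1 − ζ⁵) = 𝔓₃`, `(π₃)² = (3)`; `𝔮₃ = 𝔓₃ ∩ K⁺` has
  residue degree `2`, `N_{K⁺/ℚ}(𝔮₃) = 9`): `twistSet_fifteen_three` (`X = {2, 4, 7, 14}`, `|A_π|/2 = 3`),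
  `map_type_pow_fifteen_three`, **`exists_type_fifteen_three_sqrt_neg_fifteen/_three`**, headline, xor.

So the two NO rows of the fourfold census carry `ι`-compatible polarisations of degrees `5` and `9` (but not `1`); the
flip `|A_π|/2 = 3` odd means `N_{K⁺/ℚ}(π) < 0` for both generators (Artin parity: `𝔮₅`, `𝔮₃` are inert in
`ℚ(ζ₁₅)/ℚ(ζ₁₅)⁺`), in accordance with part 77.  COMPONENTS (S-pencil, b01.41 (C)'s rule «class of a type-`𝔣₀` point on a
NO row = `[N_{K⁺/ℚ}(𝔣₀)]`», not decided here): type `𝔮₅` (`[5]`): rows W4.3.5 (`T = {3,5}`) and `(2, ℚ(√−15), [5] = [2])`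
— NON-split; type `𝔮₃` (`[9] = [1]`): the SPLIT rows W4.3.1 / W4.15.1.

HONEST FRAMING: torus-level statements about Shimura's divisors `X_ζ′` of type `(K; Φ; 𝔣₀)` on `ℂ^Φ/Φ(ℤ[ζ₁₅])`
[Sh98 §14.3 Prop. 4–5] and elementary ideal arithmetic in `ℤ[ζ₁₅]`; all residue sets displayed and `decide`d; the
component statement is docstring-level; nothing here is a statement about Hodge classes, `W_K`, general members or HC;
`HC_CM` is used nowhere.  No `def`, no named fact, no `sorry`.

References: [cite: Shimura1998, §14.3 Prop. 4–5, pp. 103–104]; [cite: Washington1997, Lemma 1.4, Prop. 2.8]; census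
b01.41 (C), b01.46 (seat-derived).
-/

noncomputable section

open Polynomial NumberField Complex Finset
open scoped Real nonZeroDivisors

namespace Summit.HodgeConjecture.Ring2WeilCoverage.RamifiedTypesLevel15

open Literature.AlgebraicGeometry.Motives (CMType)
open Literature.AlgebraicGeometry.HodgeTheory (IsCMTypeSet)
open Literature.AlgebraicGeometry.ComplexMultiplication.CyclotomicCMType (isCMTypeSet_residueFilter)
open Literature.NumberTheory.ComplexMultiplication
open Summit.HodgeConjecture.Ring2WeilCoverage.RamifiedTypes
open Summit.HodgeConjecture.Ring2WeilCoverage.RamifiedPrimePowers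
open Summit.HodgeConjecture.Ring2WeilCoverage.RamifiedPrimePowerFive (span_one_sub_pow_eq_five)
open Summit.HodgeConjecture.Ring2WeilCoverage.CyclotomicUnitProducts (isUnit_one_sub_toInteger_pow)
open Summit.HodgeConjecture.Ring2WeilCoverage.CMTypeSetPairCount (card_inter_add_card_inter_eq)
open Summit.HodgeConjecture.Ring2WeilCoverage.CMTypeSetOddPositions (two_mul_card_eq_card_units)
open Summit.HodgeConjecture.Ring2WeilCoverage.CyclotomicSignaturesG4 (exists_units_sign_eq_fifteen)
open Summit.HodgeConjecture.Ring2WeilCoverage.RealUnitNormAllLevels (norm_realUnits_pos_fifteen)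

variable {K : Type} [Field K] [NumberField K] {ζ : K}

/-- `𝐞(t) = exp(2πi t/n) ∈ ℂ` (`ZMod.toCircle`). -/
local notation3 (prettyPrint := false) "𝐞 " t:max => ((ZMod.toCircle t : Circle) : ℂ)

/-- the residue set `S_Φ` read at level `15`. -/
local notation3 (prettyPrint := false) "SΦ[" Φ "," z "]" =>
  (Finset.univ.filter fun t : ZMod 15 => ∃ σ ∈ (Φ : CMType K).1, σ (z : K) = 𝐞 t)

/-- part 48's twisted sign set `X_π` at level `15` (`n := 15`). -/
local notation3 (prettyPrint := false) "Xtw15 " x:max =>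
  (Finset.univ.filter fun t : ZMod 15 => t.val.Coprime 15 ∧
    ¬ ((15 < (x : ℕ × ℕ × ℕ).1 * ZMod.val t % (2 * 15) ↔ 15 < (x : ℕ × ℕ × ℕ).2.1 * ZMod.val t % (2 * 15)) ↔
      Even (Finset.card (Finset.filter (fun s : ZMod 15 => s.val.Coprime 15 ∧ s.val < t.val) Finset.univ))))

/-- the census's `N_odd` at level `15` (part 5). -/
local notation3 (prettyPrint := false) "Nodd15" =>
  (Finset.univ.filter fun t : ZMod 15 => t.val.Coprime 15 ∧
    Even (Finset.card (Finset.filter (fun s : ZMod 15 => s.val.Coprime 15 ∧ s.val < t.val) Finset.univ)))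

/-- **`N_odd(15) = {1, 4, 8, 13}`** (`decide`). [folklore] -/
theorem nodd_fifteen_eq : Nodd15 = ({1, 4, 8, 13} : Finset (ZMod 15)) := by
  decide

/-! ### The type `𝔮₅`: `𝔬𝔣₀ = (π₅)`, `π₅ = ζ^13(1 − ζ^3)(1 − ζ)` (`ζ³` a primitive `5`-th root: `(π₅) = (1 − ζ³)`, `(π₅)⁴ = (5)`) -/

section Five

/-- the semi-admissibility of `x = (3, 1, 13)` at level `15` (`15 ∤ 3, 1`; `2·13 + 3 + 1 ≡ 0 (mod 30)`). [folklore] -/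
theorem adm_fifteen_five : ¬ 15 ∣ ((3, 1, 13) : ℕ × ℕ × ℕ).1 ∧ ¬ 15 ∣ ((3, 1, 13) : ℕ × ℕ × ℕ).2.1 ∧
    (2 * ((3, 1, 13) : ℕ × ℕ × ℕ).2.2 + ((3, 1, 13) : ℕ × ℕ × ℕ).1 + ((3, 1, 13) : ℕ × ℕ × ℕ).2.1) % (2 * 15) = 0 := by
  decide

/-- **The twisted sign set at level `15` for `π₅ = ζ^13(1 − ζ^3)(1 − ζ)`: `X_π = N_odd ∆ A_π = {2, 8, 11, 14}`**
(`A_π = {1, 2, 4, 11, 13, 14}`, `|A_π|/2 = 3`; `decide`) — equal to `N_{ℚ(√−3)} = {t ≡ 2 (3)}`.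
research route conditional on HC_CM; not a corollary; Q11.4-sentence-2 already refuted in dim ≥ 3. [folklore] -/
theorem twistSet_fifteen_five : Xtw15 ((3, 1, 13) : ℕ × ℕ × ℕ) = ({2, 8, 11, 14} : Finset (ZMod 15)) := by
  decide

/-- **A type `𝔣₀ ⊆ 𝓞 K⁺` with `𝔬𝔣₀ = (π₅)`, `π₅ = ζ^13(1 − ζ^3)(1 − ζ)`, EXISTS** (part 48 `exists_ideal_map_eq_span_gen`).
research route conditional on HC_CM; not a corollary; Q11.4-sentence-2 already refuted in dim ≥ 3. [cite: Shimura1998, §14.3, p. 103] -/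
theorem exists_type_ideal_fifteen_five [IsCMField K] (hζ : IsPrimitiveRoot ζ 15) :
    ∃ 𝔣₀ : Ideal (𝓞 (maximalRealSubfield K)),
      𝔣₀.map (algebraMap (𝓞 (maximalRealSubfield K)) (𝓞 K)) =
        Ideal.span {hζ.toInteger ^ 13 * (1 - hζ.toInteger ^ 3) * (1 - hζ.toInteger ^ 1)} :=
  exists_ideal_map_eq_span_gen (x := ((3, 1, 13) : ℕ × ℕ × ℕ)) hζ adm_fifteen_five

omit [NumberField K] in
/-- **`(𝔬𝔣₀)⁴ = (5)`** for the type `𝔣₀` with `𝔬𝔣₀ = (π₅)`: `(π₅) = (1 − ζ³)` (the factors `ζ¹³`, `1 − ζ` are units, part 13)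
and `(1 − ζ³)⁴ = (5)` (part 48c′, `ζ³` a primitive `5`-th root of unity) — so `N(𝔬𝔣₀) = 5²`, `N_{K⁺/ℚ}(𝔣₀) = 5`: a
polarisation of type `𝔣₀` on `ℂ^Φ/Φ(ℤ[ζ₁₅])` has degree `5`.
research route conditional on HC_CM; not a corollary; Q11.4-sentence-2 already refuted in dim ≥ 3. [cite: Washington1997, Lemma 1.4, Prop. 2.8] -/
theorem map_type_pow_fifteen_five (hζ : IsPrimitiveRoot ζ 15) {𝔣₀ : Ideal (𝓞 (maximalRealSubfield K))}
    (h𝔣₀ : 𝔣₀.map (algebraMap (𝓞 (maximalRealSubfield K)) (𝓞 K)) =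
      Ideal.span {hζ.toInteger ^ 13 * (1 - hζ.toInteger ^ 3) * (1 - hζ.toInteger ^ 1)}) :
    𝔣₀.map (algebraMap (𝓞 (maximalRealSubfield K)) (𝓞 K)) ^ 4 = Ideal.span {(5 : 𝓞 K)} := by
  have hη : IsPrimitiveRoot (ζ ^ 3) 5 := hζ.pow (by norm_num) (by norm_num)
  have hηint : hη.toInteger = hζ.toInteger ^ 3 := RingOfIntegers.ext (by simp [IsPrimitiveRoot.toInteger])
  have hu1 : IsUnit (hζ.toInteger ^ 13 : 𝓞 K) := (hζ.toInteger_isPrimitiveRoot.isUnit (by norm_num)).pow 13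
  have hu2 : IsUnit (1 - hζ.toInteger ^ 1 : 𝓞 K) := isUnit_one_sub_toInteger_pow hζ (by decide) (by decide +kernel)
  rw [h𝔣₀, Ideal.span_singleton_mul_right_unit hu2, Ideal.span_singleton_mul_left_unit hu1, ← hηint]
  exact span_one_sub_pow_eq_five hη

open scoped Classical in
/-- **ROW `(ℚ(ζ₁₅), ℚ(√−15))` (NO for principal polarisations) — THE TYPE `𝔮₅` EXISTS: for every CM type `Φ` of
`ℚ(ζ₁₅)` balanced for `N_K = {7, 11, 13, 14}` (Weil signature `(2,2)` on `K = ℚ(√−15)`) and every type `𝔣₀` with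
`𝔬𝔣₀ = (π₅)`, the principal CM torus `ℂ^Φ/Φ(ℤ[ζ₁₅])` CARRIES a `Φ`-positive divisor `X_ζ′` of type `(K; Φ; 𝔣₀)`** — an
`ι`-compatible polarisation whose `φ_X` is the `𝔬𝔣₀`-multiplication, of degree `5` [Sh98 §14.3 Prop. 4].  Proof: part 48
`exists_type_of_even` + THEOREM L (ii) at `15` (part 75) + the residue count `|S_Φ ∩ X_π| ≡ |X_π ∖ N_K| + g/2 = 2 + 2`.
research route conditional on HC_CM; not a corollary; Q11.4-sentence-2 already refuted in dim ≥ 3. [cite: Shimura1998, §14.3 Prop. 4–5, pp. 103–104] -/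
theorem exists_type_fifteen_five_sqrt_neg_fifteen [IsCMField K] [IsCyclotomicExtension {15} ℚ K]
    (hζ : IsPrimitiveRoot ζ 15) (Φ : CMType K)
    (hbal : 2 * (SΦ[Φ, ζ] ∩ ({7, 11, 13, 14} : Finset (ZMod 15))).card = (SΦ[Φ, ζ]).card)
    {𝔣₀ : Ideal (𝓞 (maximalRealSubfield K))}
    (h𝔣₀ : 𝔣₀.map (algebraMap (𝓞 (maximalRealSubfield K)) (𝓞 K)) =
      Ideal.span {hζ.toInteger ^ 13 * (1 - hζ.toInteger ^ 3) * (1 - hζ.toInteger ^ 1)}) :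
    ∃ ζ' : K, IsCMField.complexConj K ζ' = -ζ' ∧ (∀ φ : Φ.1, 0 < (φ.1 ζ').im) ∧
        CMTypeLattice.IsOfType (1 : (FractionalIdeal (𝓞 K)⁰ K)ˣ) ζ' 𝔣₀ := by
  have hg : Nat.totient 15 = 2 * (3 + 1) := by decide
  refine exists_type_of_even hζ hg adm_fifteen_five Φ h𝔣₀ (exists_units_sign_eq_fifteen hζ Φ) ?_
  rw [twistSet_fifteen_five]
  have hS := isCMTypeSet_residueFilter hζ Φ
  have hX : IsCMTypeSet 15 ({2, 8, 11, 14} : Finset (ZMod 15)) := by decide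
  have hNK : IsCMTypeSet 15 ({7, 11, 13, 14} : Finset (ZMod 15)) := by decide
  have h1 := card_inter_mod_two_eq hS hX hNK
  have h2 := two_mul_card_eq_card_units hS
  have hU : (Finset.univ.filter fun t : ZMod 15 => t.val.Coprime 15).card = 8 := by decide
  have h3 : (({2, 8, 11, 14} : Finset (ZMod 15)) \ ({7, 11, 13, 14} : Finset (ZMod 15))).card = 2 := by decide
  rw [Nat.even_iff]
  omega

open scoped Classical in
/-- **ROW `(ℚ(ζ₁₅), ℚ(√−3))` (NO for principal polarisations) — THE TYPE `𝔮₅` EXISTS: for every CM type `Φ` of `ℚ(ζ₁₅)`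
balanced for `N_K = {2, 8, 11, 14}` (`K = ℚ(√−3)`) and every `𝔣₀` with `𝔬𝔣₀ = (π₅)`, `ℂ^Φ/Φ(ℤ[ζ₁₅])` carries a `Φ`-positive
divisor of type `(K; Φ; 𝔣₀)`** (degree `5`; here `X_π = N_K`, so `|S_Φ ∩ X_π| = g/2 = 2` is even for every balanced `Φ`).
research route conditional on HC_CM; not a corollary; Q11.4-sentence-2 already refuted in dim ≥ 3. [cite: Shimura1998, §14.3 Prop. 4–5, pp. 103–104] -/
theorem exists_type_fifteen_five_sqrt_neg_three [IsCMField K] [IsCyclotomicExtension {15} ℚ K]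
    (hζ : IsPrimitiveRoot ζ 15) (Φ : CMType K)
    (hbal : 2 * (SΦ[Φ, ζ] ∩ ({2, 8, 11, 14} : Finset (ZMod 15))).card = (SΦ[Φ, ζ]).card)
    {𝔣₀ : Ideal (𝓞 (maximalRealSubfield K))}
    (h𝔣₀ : 𝔣₀.map (algebraMap (𝓞 (maximalRealSubfield K)) (𝓞 K)) =
      Ideal.span {hζ.toInteger ^ 13 * (1 - hζ.toInteger ^ 3) * (1 - hζ.toInteger ^ 1)}) :
    ∃ ζ' : K, IsCMField.complexConj K ζ' = -ζ' ∧ (∀ φ : Φ.1, 0 < (φ.1 ζ').im) ∧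
        CMTypeLattice.IsOfType (1 : (FractionalIdeal (𝓞 K)⁰ K)ˣ) ζ' 𝔣₀ := by
  have hg : Nat.totient 15 = 2 * (3 + 1) := by decide
  refine exists_type_of_even hζ hg adm_fifteen_five Φ h𝔣₀ (exists_units_sign_eq_fifteen hζ Φ) ?_
  rw [twistSet_fifteen_five]
  have hS := isCMTypeSet_residueFilter hζ Φ
  have h2 := two_mul_card_eq_card_units hS
  have hU : (Finset.univ.filter fun t : ZMod 15 => t.val.Coprime 15).card = 8 := by decide
  rw [Nat.even_iff]
  omega

open scoped Classical in
/-- **Headline: there is a type `𝔣₀ ⊆ 𝓞 K⁺` with `(𝔬𝔣₀)⁴ = (5)` — degree `5` — such that `ℂ^Φ/Φ(ℤ[ζ₁₅])` carries a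
`Φ`-positive divisor of type `(K; Φ; 𝔣₀)` for EVERY `ℚ(√−15)`-balanced CM type `Φ`** (the NO row gets an explicit
NON-principal `ι`-compatible polarisation).
research route conditional on HC_CM; not a corollary; Q11.4-sentence-2 already refuted in dim ≥ 3. [cite: Shimura1998, §14.3 Prop. 4–5, pp. 103–104] -/
theorem exists_ramifiedType_fifteen_five_sqrt_neg_fifteen [IsCMField K] [IsCyclotomicExtension {15} ℚ K]
    (hζ : IsPrimitiveRoot ζ 15) (Φ : CMType K)
    (hbal : 2 * (SΦ[Φ, ζ] ∩ ({7, 11, 13, 14} : Finset (ZMod 15))).card = (SΦ[Φ, ζ]).card) :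
    ∃ 𝔣₀ : Ideal (𝓞 (maximalRealSubfield K)),
      𝔣₀.map (algebraMap (𝓞 (maximalRealSubfield K)) (𝓞 K)) ^ 4 = Ideal.span {(5 : 𝓞 K)} ∧
      ∃ ζ' : K, IsCMField.complexConj K ζ' = -ζ' ∧ (∀ φ : Φ.1, 0 < (φ.1 ζ').im) ∧
        CMTypeLattice.IsOfType (1 : (FractionalIdeal (𝓞 K)⁰ K)ˣ) ζ' 𝔣₀ := by
  obtain ⟨𝔣₀, h𝔣₀⟩ := exists_type_ideal_fifteen_five hζ
  exact ⟨𝔣₀, map_type_pow_fifteen_five hζ h𝔣₀, exists_type_fifteen_five_sqrt_neg_fifteen hζ Φ hbal h𝔣₀⟩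

open scoped Classical in
/-- **Headline for `K = ℚ(√−3)`**: a type `𝔣₀` with `(𝔬𝔣₀)⁴ = (5)` occurs on `ℂ^Φ/Φ(ℤ[ζ₁₅])` for EVERY
`ℚ(√−3)`-balanced CM type `Φ`.
research route conditional on HC_CM; not a corollary; Q11.4-sentence-2 already refuted in dim ≥ 3. [cite: Shimura1998, §14.3 Prop. 4–5, pp. 103–104] -/
theorem exists_ramifiedType_fifteen_five_sqrt_neg_three [IsCMField K] [IsCyclotomicExtension {15} ℚ K]
    (hζ : IsPrimitiveRoot ζ 15) (Φ : CMType K)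
    (hbal : 2 * (SΦ[Φ, ζ] ∩ ({2, 8, 11, 14} : Finset (ZMod 15))).card = (SΦ[Φ, ζ]).card) :
    ∃ 𝔣₀ : Ideal (𝓞 (maximalRealSubfield K)),
      𝔣₀.map (algebraMap (𝓞 (maximalRealSubfield K)) (𝓞 K)) ^ 4 = Ideal.span {(5 : 𝓞 K)} ∧
      ∃ ζ' : K, IsCMField.complexConj K ζ' = -ζ' ∧ (∀ φ : Φ.1, 0 < (φ.1 ζ').im) ∧
        CMTypeLattice.IsOfType (1 : (FractionalIdeal (𝓞 K)⁰ K)ˣ) ζ' 𝔣₀ := by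
  obtain ⟨𝔣₀, h𝔣₀⟩ := exists_type_ideal_fifteen_five hζ
  exact ⟨𝔣₀, map_type_pow_fifteen_five hζ h𝔣₀, exists_type_fifteen_five_sqrt_neg_three hζ Φ hbal h𝔣₀⟩

open scoped Classical in
/-- **DICHOTOMY AT LEVEL `15` for the type `𝔮₅`: every one of the `16` CM types `Φ` of `ℚ(ζ₁₅)` makes `ℂ^Φ/Φ(ℤ[ζ₁₅])`
carry EITHER an `ι`-compatible principal polarisation OR a `Φ`-positive divisor of type `𝔣₀` (`𝔬𝔣₀ = (π₅)`), NEVER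
BOTH** — `|N_odd ∖ X_π| = |A_π|/2 = 3` is odd (equivalently `N_{K⁺/ℚ}(π₅) < 0`), THEOREM L (i)/(ii) at `15`, part 48
`exists_principal_xor_exists_type`.
research route conditional on HC_CM; not a corollary; Q11.4-sentence-2 already refuted in dim ≥ 3. [cite: Shimura1998, §14.3 Prop. 5, p. 104] -/
theorem exists_principal_xor_type_fifteen_five [IsCMField K] [IsCyclotomicExtension {15} ℚ K]
    (hζ : IsPrimitiveRoot ζ 15) (Φ : CMType K) {𝔣₀ : Ideal (𝓞 (maximalRealSubfield K))}
    (h𝔣₀ : 𝔣₀.map (algebraMap (𝓞 (maximalRealSubfield K)) (𝓞 K)) =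
      Ideal.span {hζ.toInteger ^ 13 * (1 - hζ.toInteger ^ 3) * (1 - hζ.toInteger ^ 1)}) :
    Xor (∃ ζ' : K, IsCMField.complexConj K ζ' = -ζ' ∧ (∀ φ : Φ.1, 0 < (φ.1 ζ').im) ∧
          CMTypeLattice.IsOfType (1 : (FractionalIdeal (𝓞 K)⁰ K)ˣ) ζ' ⊤)
      (∃ ζ' : K, IsCMField.complexConj K ζ' = -ζ' ∧ (∀ φ : Φ.1, 0 < (φ.1 ζ').im) ∧
          CMTypeLattice.IsOfType (1 : (FractionalIdeal (𝓞 K)⁰ K)ˣ) ζ' 𝔣₀) := by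
  have hg : Nat.totient 15 = 2 * (3 + 1) := by decide
  refine exists_principal_xor_exists_type hζ hg adm_fifteen_five Φ h𝔣₀ (norm_realUnits_pos_fifteen hζ)
    (exists_units_sign_eq_fifteen hζ Φ) ?_
  rw [twistSet_fifteen_five, nodd_fifteen_eq]
  have hS := isCMTypeSet_residueFilter hζ Φ
  have hN : IsCMTypeSet 15 ({1, 4, 8, 13} : Finset (ZMod 15)) := by decide
  have hX : IsCMTypeSet 15 ({2, 8, 11, 14} : Finset (ZMod 15)) := by decide
  have h := card_inter_add_card_inter_eq hS hN hX
  have hd : (({1, 4, 8, 13} : Finset (ZMod 15)) \ ({2, 8, 11, 14} : Finset (ZMod 15))).card = 3 := by decide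
  omega

end Five

/-! ### The type `𝔮₃`: `𝔬𝔣₀ = (π₃)`, `π₃ = ζ^12(1 − ζ^5)(1 − ζ)` (`ζ⁵` a primitive cube root: `(π₃) = (1 − ζ⁵)`, `(π₃)² = (3)`) -/

section Three

/-- the semi-admissibility of `x = (5, 1, 12)` at level `15` (`15 ∤ 5, 1`; `2·12 + 5 + 1 ≡ 0 (mod 30)`). [folklore] -/
theorem adm_fifteen_three : ¬ 15 ∣ ((5, 1, 12) : ℕ × ℕ × ℕ).1 ∧ ¬ 15 ∣ ((5, 1, 12) : ℕ × ℕ × ℕ).2.1 ∧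
    (2 * ((5, 1, 12) : ℕ × ℕ × ℕ).2.2 + ((5, 1, 12) : ℕ × ℕ × ℕ).1 + ((5, 1, 12) : ℕ × ℕ × ℕ).2.1) % (2 * 15) = 0 := by
  decide

/-- **The twisted sign set at level `15` for `π₃ = ζ^12(1 − ζ^5)(1 − ζ)`: `X_π = N_odd ∆ A_π = {2, 4, 7, 14}`**
(`A_π = {1, 2, 7, 8, 13, 14}`, `|A_π|/2 = 3`; `decide`).
research route conditional on HC_CM; not a corollary; Q11.4-sentence-2 already refuted in dim ≥ 3. [folklore] -/
theorem twistSet_fifteen_three : Xtw15 ((5, 1, 12) : ℕ × ℕ × ℕ) = ({2, 4, 7, 14} : Finset (ZMod 15)) := by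
  decide

/-- **A type `𝔣₀ ⊆ 𝓞 K⁺` with `𝔬𝔣₀ = (π₃)`, `π₃ = ζ^12(1 − ζ^5)(1 − ζ)`, EXISTS** (part 48 `exists_ideal_map_eq_span_gen`).
research route conditional on HC_CM; not a corollary; Q11.4-sentence-2 already refuted in dim ≥ 3. [cite: Shimura1998, §14.3, p. 103] -/
theorem exists_type_ideal_fifteen_three [IsCMField K] (hζ : IsPrimitiveRoot ζ 15) :
    ∃ 𝔣₀ : Ideal (𝓞 (maximalRealSubfield K)),
      𝔣₀.map (algebraMap (𝓞 (maximalRealSubfield K)) (𝓞 K)) =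
        Ideal.span {hζ.toInteger ^ 12 * (1 - hζ.toInteger ^ 5) * (1 - hζ.toInteger ^ 1)} :=
  exists_ideal_map_eq_span_gen (x := ((5, 1, 12) : ℕ × ℕ × ℕ)) hζ adm_fifteen_three

omit [NumberField K] in
/-- **`(𝔬𝔣₀)² = (3)`** for the type `𝔣₀` with `𝔬𝔣₀ = (π₃)`: `(π₃) = (1 − ζ⁵)` (units `ζ¹²`, `1 − ζ`) and `(1 − ζ⁵)² = (3)`
(part 48c, `ζ⁵` a primitive cube root of unity) — so `N(𝔬𝔣₀) = 3⁴`, `N_{K⁺/ℚ}(𝔣₀) = 9`: a polarisation of type `𝔣₀`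
on `ℂ^Φ/Φ(ℤ[ζ₁₅])` has degree `9`.
research route conditional on HC_CM; not a corollary; Q11.4-sentence-2 already refuted in dim ≥ 3. [cite: Washington1997, Lemma 1.4, Prop. 2.8] -/
theorem map_type_pow_fifteen_three (hζ : IsPrimitiveRoot ζ 15) {𝔣₀ : Ideal (𝓞 (maximalRealSubfield K))}
    (h𝔣₀ : 𝔣₀.map (algebraMap (𝓞 (maximalRealSubfield K)) (𝓞 K)) =
      Ideal.span {hζ.toInteger ^ 12 * (1 - hζ.toInteger ^ 5) * (1 - hζ.toInteger ^ 1)}) :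
    𝔣₀.map (algebraMap (𝓞 (maximalRealSubfield K)) (𝓞 K)) ^ 2 = Ideal.span {(3 : 𝓞 K)} := by
  have hη : IsPrimitiveRoot (ζ ^ 5) 3 := hζ.pow (by norm_num) (by norm_num)
  have hηint : hη.toInteger = hζ.toInteger ^ 5 := RingOfIntegers.ext (by simp [IsPrimitiveRoot.toInteger])
  have hu1 : IsUnit (hζ.toInteger ^ 12 : 𝓞 K) := (hζ.toInteger_isPrimitiveRoot.isUnit (by norm_num)).pow 12
  have hu2 : IsUnit (1 - hζ.toInteger ^ 1 : 𝓞 K) := isUnit_one_sub_toInteger_pow hζ (by decide) (by decide +kernel)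
  rw [h𝔣₀, Ideal.span_singleton_mul_right_unit hu2, Ideal.span_singleton_mul_left_unit hu1, ← hηint]
  exact span_one_sub_pow_eq_three hη

open scoped Classical in
/-- **ROW `(ℚ(ζ₁₅), ℚ(√−15))` — THE TYPE `𝔮₃` EXISTS: for every CM type `Φ` balanced for `N_K = {7, 11, 13, 14}` and every
`𝔣₀` with `𝔬𝔣₀ = (π₃)`, `ℂ^Φ/Φ(ℤ[ζ₁₅])` carries a `Φ`-positive divisor of type `(K; Φ; 𝔣₀)`** (degree `9`;
`|S_Φ ∩ X_π| ≡ |X_π ∖ N_K| + g/2 = 2 + 2`).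
research route conditional on HC_CM; not a corollary; Q11.4-sentence-2 already refuted in dim ≥ 3. [cite: Shimura1998, §14.3 Prop. 4–5, pp. 103–104] -/
theorem exists_type_fifteen_three_sqrt_neg_fifteen [IsCMField K] [IsCyclotomicExtension {15} ℚ K]
    (hζ : IsPrimitiveRoot ζ 15) (Φ : CMType K)
    (hbal : 2 * (SΦ[Φ, ζ] ∩ ({7, 11, 13, 14} : Finset (ZMod 15))).card = (SΦ[Φ, ζ]).card)
    {𝔣₀ : Ideal (𝓞 (maximalRealSubfield K))}
    (h𝔣₀ : 𝔣₀.map (algebraMap (𝓞 (maximalRealSubfield K)) (𝓞 K)) =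
      Ideal.span {hζ.toInteger ^ 12 * (1 - hζ.toInteger ^ 5) * (1 - hζ.toInteger ^ 1)}) :
    ∃ ζ' : K, IsCMField.complexConj K ζ' = -ζ' ∧ (∀ φ : Φ.1, 0 < (φ.1 ζ').im) ∧
        CMTypeLattice.IsOfType (1 : (FractionalIdeal (𝓞 K)⁰ K)ˣ) ζ' 𝔣₀ := by
  have hg : Nat.totient 15 = 2 * (3 + 1) := by decide
  refine exists_type_of_even hζ hg adm_fifteen_three Φ h𝔣₀ (exists_units_sign_eq_fifteen hζ Φ) ?_
  rw [twistSet_fifteen_three]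
  have hS := isCMTypeSet_residueFilter hζ Φ
  have hX : IsCMTypeSet 15 ({2, 4, 7, 14} : Finset (ZMod 15)) := by decide
  have hNK : IsCMTypeSet 15 ({7, 11, 13, 14} : Finset (ZMod 15)) := by decide
  have h1 := card_inter_mod_two_eq hS hX hNK
  have h2 := two_mul_card_eq_card_units hS
  have hU : (Finset.univ.filter fun t : ZMod 15 => t.val.Coprime 15).card = 8 := by decide
  have h3 : (({2, 4, 7, 14} : Finset (ZMod 15)) \ ({7, 11, 13, 14} : Finset (ZMod 15))).card = 2 := by decide
  rw [Nat.even_iff]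
  omega

open scoped Classical in
/-- **ROW `(ℚ(ζ₁₅), ℚ(√−3))` — THE TYPE `𝔮₃` EXISTS** for every CM type `Φ` balanced for `N_K = {2, 8, 11, 14}` (degree
`9`; `|S_Φ ∩ X_π| ≡ 2 + 2`).
research route conditional on HC_CM; not a corollary; Q11.4-sentence-2 already refuted in dim ≥ 3. [cite: Shimura1998, §14.3 Prop. 4–5, pp. 103–104] -/
theorem exists_type_fifteen_three_sqrt_neg_three [IsCMField K] [IsCyclotomicExtension {15} ℚ K]
    (hζ : IsPrimitiveRoot ζ 15) (Φ : CMType K)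
    (hbal : 2 * (SΦ[Φ, ζ] ∩ ({2, 8, 11, 14} : Finset (ZMod 15))).card = (SΦ[Φ, ζ]).card)
    {𝔣₀ : Ideal (𝓞 (maximalRealSubfield K))}
    (h𝔣₀ : 𝔣₀.map (algebraMap (𝓞 (maximalRealSubfield K)) (𝓞 K)) =
      Ideal.span {hζ.toInteger ^ 12 * (1 - hζ.toInteger ^ 5) * (1 - hζ.toInteger ^ 1)}) :
    ∃ ζ' : K, IsCMField.complexConj K ζ' = -ζ' ∧ (∀ φ : Φ.1, 0 < (φ.1 ζ').im) ∧
        CMTypeLattice.IsOfType (1 : (FractionalIdeal (𝓞 K)⁰ K)ˣ) ζ' 𝔣₀ := by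
  have hg : Nat.totient 15 = 2 * (3 + 1) := by decide
  refine exists_type_of_even hζ hg adm_fifteen_three Φ h𝔣₀ (exists_units_sign_eq_fifteen hζ Φ) ?_
  rw [twistSet_fifteen_three]
  have hS := isCMTypeSet_residueFilter hζ Φ
  have hX : IsCMTypeSet 15 ({2, 4, 7, 14} : Finset (ZMod 15)) := by decide
  have hNK : IsCMTypeSet 15 ({2, 8, 11, 14} : Finset (ZMod 15)) := by decide
  have h1 := card_inter_mod_two_eq hS hX hNK
  have h2 := two_mul_card_eq_card_units hS
  have hU : (Finset.univ.filter fun t : ZMod 15 => t.val.Coprime 15).card = 8 := by decide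
  have h3 : (({2, 4, 7, 14} : Finset (ZMod 15)) \ ({2, 8, 11, 14} : Finset (ZMod 15))).card = 2 := by decide
  rw [Nat.even_iff]
  omega

open scoped Classical in
/-- **Headline: a type `𝔣₀` with `(𝔬𝔣₀)² = (3)` — degree `9` — occurs on `ℂ^Φ/Φ(ℤ[ζ₁₅])` for EVERY `ℚ(√−15)`-balanced
CM type `Φ`.**
research route conditional on HC_CM; not a corollary; Q11.4-sentence-2 already refuted in dim ≥ 3. [cite: Shimura1998, §14.3 Prop. 4–5, pp. 103–104] -/
theorem exists_ramifiedType_fifteen_three_sqrt_neg_fifteen [IsCMField K] [IsCyclotomicExtension {15} ℚ K]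
    (hζ : IsPrimitiveRoot ζ 15) (Φ : CMType K)
    (hbal : 2 * (SΦ[Φ, ζ] ∩ ({7, 11, 13, 14} : Finset (ZMod 15))).card = (SΦ[Φ, ζ]).card) :
    ∃ 𝔣₀ : Ideal (𝓞 (maximalRealSubfield K)),
      𝔣₀.map (algebraMap (𝓞 (maximalRealSubfield K)) (𝓞 K)) ^ 2 = Ideal.span {(3 : 𝓞 K)} ∧
      ∃ ζ' : K, IsCMField.complexConj K ζ' = -ζ' ∧ (∀ φ : Φ.1, 0 < (φ.1 ζ').im) ∧
        CMTypeLattice.IsOfType (1 : (FractionalIdeal (𝓞 K)⁰ K)ˣ) ζ' 𝔣₀ := by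
  obtain ⟨𝔣₀, h𝔣₀⟩ := exists_type_ideal_fifteen_three hζ
  exact ⟨𝔣₀, map_type_pow_fifteen_three hζ h𝔣₀, exists_type_fifteen_three_sqrt_neg_fifteen hζ Φ hbal h𝔣₀⟩

open scoped Classical in
/-- **Headline for `K = ℚ(√−3)`**: a type `𝔣₀` with `(𝔬𝔣₀)² = (3)` occurs on `ℂ^Φ/Φ(ℤ[ζ₁₅])` for EVERY `ℚ(√−3)`-balanced
CM type `Φ`.
research route conditional on HC_CM; not a corollary; Q11.4-sentence-2 already refuted in dim ≥ 3. [cite: Shimura1998, §14.3 Prop. 4–5, pp. 103–104] -/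
theorem exists_ramifiedType_fifteen_three_sqrt_neg_three [IsCMField K] [IsCyclotomicExtension {15} ℚ K]
    (hζ : IsPrimitiveRoot ζ 15) (Φ : CMType K)
    (hbal : 2 * (SΦ[Φ, ζ] ∩ ({2, 8, 11, 14} : Finset (ZMod 15))).card = (SΦ[Φ, ζ]).card) :
    ∃ 𝔣₀ : Ideal (𝓞 (maximalRealSubfield K)),
      𝔣₀.map (algebraMap (𝓞 (maximalRealSubfield K)) (𝓞 K)) ^ 2 = Ideal.span {(3 : 𝓞 K)} ∧
      ∃ ζ' : K, IsCMField.complexConj K ζ' = -ζ' ∧ (∀ φ : Φ.1, 0 < (φ.1 ζ').im) ∧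
        CMTypeLattice.IsOfType (1 : (FractionalIdeal (𝓞 K)⁰ K)ˣ) ζ' 𝔣₀ := by
  obtain ⟨𝔣₀, h𝔣₀⟩ := exists_type_ideal_fifteen_three hζ
  exact ⟨𝔣₀, map_type_pow_fifteen_three hζ h𝔣₀, exists_type_fifteen_three_sqrt_neg_three hζ Φ hbal h𝔣₀⟩

open scoped Classical in
/-- **DICHOTOMY AT LEVEL `15` for the type `𝔮₃`: every CM type `Φ` of `ℚ(ζ₁₅)` makes `ℂ^Φ/Φ(ℤ[ζ₁₅])` carry EITHER an
`ι`-compatible principal polarisation OR a `Φ`-positive divisor of type `𝔣₀` (`𝔬𝔣₀ = (π₃)`), NEVER BOTH**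
(`|N_odd ∖ X_π| = 3` odd ⟺ `N_{K⁺/ℚ}(π₃) < 0`).
research route conditional on HC_CM; not a corollary; Q11.4-sentence-2 already refuted in dim ≥ 3. [cite: Shimura1998, §14.3 Prop. 5, p. 104] -/
theorem exists_principal_xor_type_fifteen_three [IsCMField K] [IsCyclotomicExtension {15} ℚ K]
    (hζ : IsPrimitiveRoot ζ 15) (Φ : CMType K) {𝔣₀ : Ideal (𝓞 (maximalRealSubfield K))}
    (h𝔣₀ : 𝔣₀.map (algebraMap (𝓞 (maximalRealSubfield K)) (𝓞 K)) =
      Ideal.span {hζ.toInteger ^ 12 * (1 - hζ.toInteger ^ 5) * (1 - hζ.toInteger ^ 1)}) :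
    Xor (∃ ζ' : K, IsCMField.complexConj K ζ' = -ζ' ∧ (∀ φ : Φ.1, 0 < (φ.1 ζ').im) ∧
          CMTypeLattice.IsOfType (1 : (FractionalIdeal (𝓞 K)⁰ K)ˣ) ζ' ⊤)
      (∃ ζ' : K, IsCMField.complexConj K ζ' = -ζ' ∧ (∀ φ : Φ.1, 0 < (φ.1 ζ').im) ∧
          CMTypeLattice.IsOfType (1 : (FractionalIdeal (𝓞 K)⁰ K)ˣ) ζ' 𝔣₀) := by
  have hg : Nat.totient 15 = 2 * (3 + 1) := by decide
  refine exists_principal_xor_exists_type hζ hg adm_fifteen_three Φ h𝔣₀ (norm_realUnits_pos_fifteen hζ)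
    (exists_units_sign_eq_fifteen hζ Φ) ?_
  rw [twistSet_fifteen_three, nodd_fifteen_eq]
  have hS := isCMTypeSet_residueFilter hζ Φ
  have hN : IsCMTypeSet 15 ({1, 4, 8, 13} : Finset (ZMod 15)) := by decide
  have hX : IsCMTypeSet 15 ({2, 4, 7, 14} : Finset (ZMod 15)) := by decide
  have h := card_inter_add_card_inter_eq hS hN hX
  have hd : (({1, 4, 8, 13} : Finset (ZMod 15)) \ ({2, 4, 7, 14} : Finset (ZMod 15))).card = 3 := by decide
  omega

end Three

end Summit.HodgeConjecture.Ring2WeilCoverage.RamifiedTypesLevel15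

end
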